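/-
Origin: expansion seat `prover-pub-hodgecm-mc-binder-2-g11-0`, handover #48 2026-08-20T04:05Z md5 38311a8e7c23 (158 l.; CERTIFIED rc 0 / 0 warn / 36.9 s; `#print axioms ins_mem_SK_of_letters` ⊆ trio; imports #37 `OmgInsPin` + #40 `ArchFrameConj` + #42 `LetterIns`; THE (J-x₀) ASSEMBLY at the W pin of record `wmInputCM₂g V S hGR η hη hηc τ T hT` under `hV : IsAnisotropic` and the sign fact `hW`, for ANY place data `datum`: `pinLetterChar`, `kVLetters`, `kPair k = archProdHom (archFrameConj frameG k, 1)`, **`ins_tprod_mem_SK_of_letters`** and **`ins_mem_SK_of_letters : ∀ f φ, ins … datum m₁ m₂ f φ ∈ W₀.SK`** FROM (c) a lettering hom `lett : K_∞ →* Π_w U(V⁺_w)×U(V⁻_w)` with `hlett : letterSection (kVLetters (lett k)) = (archFrameConj … k, 1)`, (d) `hd` the per-place K_V-letter eigen-equations (supplied per datum constructor by #43/#46/#47) and (e) ONE identity `hκ : η(kPair k) · pinLetterChar (kVLetters (lett k)) · ∏_w dV k w = archKappa k` ((V-val)); proof = #40 iff + `wmInputCM₂g_ρ_eq_of` + #42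 on pure tensors + `Submodule.span_induction` over `PiTensorProduct.span_tprod_eq_top`; NAME LIST `HodgeCM.Model.HypCensus.ins_mem_SK_of_letters`, `HodgeCM.Model.HypCensus.ins_tprod_mem_SK_of_letters`, `HodgeCM.Model.HypCensus.kPair`; axioms trio) (`HOME/mc/pub-hodgecm-mc-binder-2/g11/pkg/HodgeCM/Model/HypCensus/InsMemPin.lean`, md5 38311a8e7c23, 158 lines);
landed by the second packager p2 gen 2 (p2-g2) in gate run 40 as `HodgeCM/Model/HypCensus/InsMemPin.lean` (verbatim).
-/
/-
Origin: speedrun cell pub-hodgecm, MODEL-CONSTRUCTION sub-cell, lineage mc-binder-2 (BINDER-OWNERS rows 18/19: E binders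
`hyp12` / `hyp34` of `Model.perL_picardCM_r15A`), seat prover-pub-hodgecm-mc-binder-2-g11-0 (gen 11), 2026-08-20.
Target in PKG: `HodgeCM/Model/HypCensus/InsMemPin.lean` (NEW additive leaf; imports this lineage's `HypCensus/OmgInsPin` (#37),
`HypCensus/ArchFrameConj` (#40), `HypCensus/LetterIns` (#42)).  KERNEL ONLY: 0 records, nothing cited as hypothesis, 0 `def … : Prop`.
-/
import Summits.HodgeConjecture.HodgeCM.Model.HypCensus.OmgInsPin
import Summits.HodgeConjecture.HodgeCM.Model.HypCensus.ArchFrameConj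
import Summits.HodgeConjecture.HodgeCM.Model.HypCensus.LetterIns

/-!
# Census kit (rows A12/A34), junction (J-x₀): the field `ins_mem` at the W pin of record, from the lettering and ONE identity

The (J-x₀) analogue of #37: at `W₀ = wmInputCM₂g V S hGR η hη hηc τ T hT` under the sign fact `hW` (and `hV : IsAnisotropic`), for ANY
place data `datum`, the inserted printed vectors lie in `W₀.SK = 𝒮^κ` as soon as

* (c) `lett` LETTERS `K_∞`: a hom `k ↦ (A_w(k), D_w(k))_w` with `letterSection (w ↦ ((A_w,D_w),(1,1))) = (frameG⁻¹ k frameG, 1)` (`hlett`);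
* (d) `hd`: at every real place the place polynomials are eigenvectors of the `K_V`-letter `((A_w(k), D_w(k)), (1,1))`, eigenvalue `dV k w`
  (supplied per datum constructor by #43/#46/#47);
* (e) `hκ`: ONE character identity `η(frameG⁻¹ k frameG, 1) · letterChar(letters k) · ∏_w dV k w = κ(k)` ((V-val)).

* `pinLetterChar` — the letter character of the pin (sign facts read off `HermSpace3`, as `pinTorusChar`);
* **`ins_tprod_mem_SK_of_letters`** (pure tensors), **`ins_mem_SK_of_letters`** (every printed vector, by linearity: `SK` is a submodule).

Nothing here is a claim of PerL/QW8.
-/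

set_option autoImplicit false

noncomputable section

open Filter Topology
open NumberField NumberField.InfinitePlace
open scoped TensorProduct Classical
open MvPolynomial
open Literature.NumberTheory.Automorphic Literature.NumberTheory.Automorphic.UnitaryGroup Literature.NumberTheory.Weil1964
open Literature.RepresentationTheory.KonnoKonno2007 Literature.RepresentationTheory.KonnoKonno2007.RealDualPair
open Literature.NumberTheory.GelbartRogawski1991 Literature.NumberTheory.GelbartRogawski1991.UnitaryDualPair
open Literature.Analysis.SegalBargmann
open HodgeCM HodgeCM.Model HodgeCM.Adelic
open HodgeCM.PerL34.Fock HodgeCM.PerL34.Fock.PrintDict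

namespace HodgeCM.Model.HypCensus

section Pin

variable {L : CMField} {ι₁ : L →+* ℂ} (V : HermSpace3 L ι₁) (S : StubTree.SeesawDatum L)
variable
  (hGR : (cmSplittingDatum (L : Type) finProdFinEquiv (frameD V) (frameD_real V) (frameD_ne V) (dW S) (dW_real S) (dW_ne S)).CompatibleSplitting)
  (η : CMAdelic (L : Type) (frameD V) × CMAdelic (L : Type) (dW S) →* ℂˣ)
  (hη : ∀ γU ∈ CMRat (L : Type) (frameD V), ∀ γ ∈ CMRat (L : Type) (dW S), η (γU, γ) = 1)
  (hηc : Continuous fun p => ((η p : ℂˣ) : ℂ))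
  (τ : L →+* ℂ) (T : GL (Fin 3) ℂ)
  (hT : formCongr (starRingEnd ℂ) T (V.Hm.map τ) = Literature.Geometry.ComplexHyperbolic.BallModel.J)
  (hV : IsAnisotropic L V.Hm)
  (hW : (∀ j, 0 < (ι₁ ((dW S) j)).re) ∨ ∀ j, (ι₁ ((dW S) j)).re < 0)
variable (datum : ∀ b : InfinitePlace (L : Type), PlaceDatum (L : Type) (frameD V) (frameD_real V) (dW S) (dW_real S) ι₁ (cmPlacesEquiv (L : Type) b))
  (m₁ m₂ : InfinitePlace (L : Type) → ℤ)

/-- **the letter character of the pin `(V, S)`** under the sign fact `hW` (the other sign facts READ OFF `HermSpace3` / `M = 2`). -/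
abbrev pinLetterChar :
    (∀ w : {v : InfinitePlace ↥(maximalRealSubfield L) // v.IsReal},
      DPK (PosIdx (cmXV (L : Type) (frameD V) (frameD_real V) ι₁ w)) (NegIdx (cmXV (L : Type) (frameD V) (frameD_real V) ι₁ w))
        (PosIdx (cmXW (L : Type) (frameD V) (dW S) (dW_real S) ι₁ w)) (NegIdx (cmXW (L : Type) (frameD V) (dW S) (dW_real S) ι₁ w))) →* Circle :=
  letterChar (L : Type) (frameD V) (frameD_real V) (frameD_ne V) (dW S) (dW_real S) (dW_ne S) hGR ι₁ (frameD_sign_ι₁' V) hW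
    (frameD_sign_of_ne V) (fun τ' _ => signs_fin_two fun j => re_apply_ne_zero_of_complexConj_eq (L : Type) τ' (dW_real S j) (dW_ne S j))

/-- the full letter family of a `K_V`-letter family: `W`-part `(1,1)`. -/
abbrev kVLetters
    (a : ∀ w : {v : InfinitePlace ↥(maximalRealSubfield L) // v.IsReal},
      Matrix.unitaryGroup (PosIdx (cmXV (L : Type) (frameD V) (frameD_real V) ι₁ w)) ℂ ×
        Matrix.unitaryGroup (NegIdx (cmXV (L : Type) (frameD V) (frameD_real V) ι₁ w)) ℂ) :
    ∀ w : {v : InfinitePlace ↥(maximalRealSubfield L) // v.IsReal},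
      DPK (PosIdx (cmXV (L : Type) (frameD V) (frameD_real V) ι₁ w)) (NegIdx (cmXV (L : Type) (frameD V) (frameD_real V) ι₁ w))
        (PosIdx (cmXW (L : Type) (frameD V) (dW S) (dW_real S) ι₁ w)) (NegIdx (cmXW (L : Type) (frameD V) (dW S) (dW_real S) ι₁ w)) :=
  fun w => (a w, (1, 1))

/-- the archimedean pair of a `K_∞` element at the pin: `(frameG⁻¹ k frameG, 1)`. -/
abbrev kPair (k : ↥(UnitaryGroup.archIsotropy (L : Type) V.Hm τ T hT)) :
    CMAdelic (L : Type) (frameD V) × CMAdelic (L : Type) (dW S) :=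
  archProdHom (↥(maximalRealSubfield L)) (L : Type) (IsCMField.complexConj L) 3 2 (Matrix.diagonal (frameD V)) (Matrix.diagonal (dW S))
    (archFrameConj (L : Type) 3 V.Hm (frameG V) (frameD V) (frame_congr V)
        (k : ↥(UnitaryGroup.arch (↥(maximalRealSubfield L)) (L : Type) (IsCMField.complexConj L) 3 V.Hm)),
      (1 : ↥(UnitaryGroup.arch (↥(maximalRealSubfield L)) (L : Type) (IsCMField.complexConj L) 2 (Matrix.diagonal (dW S)))))

variable
  (lett : ↥(UnitaryGroup.archIsotropy (L : Type) V.Hm τ T hT) →*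
    ∀ w : {v : InfinitePlace ↥(maximalRealSubfield L) // v.IsReal},
      Matrix.unitaryGroup (PosIdx (cmXV (L : Type) (frameD V) (frameD_real V) ι₁ w)) ℂ ×
        Matrix.unitaryGroup (NegIdx (cmXV (L : Type) (frameD V) (frameD_real V) ι₁ w)) ℂ)
  (hlett : ∀ k : ↥(UnitaryGroup.archIsotropy (L : Type) V.Hm τ T hT), letterSection (L : Type) (frameD V) (frameD_real V) (frameD_ne V) (dW S) (dW_real S) (dW_ne S) ι₁ (kVLetters V S (lett k)) =
    (archFrameConj (L : Type) 3 V.Hm (frameG V) (frameD V) (frame_congr V)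
      (k : ↥(UnitaryGroup.arch (↥(maximalRealSubfield L)) (L : Type) (IsCMField.complexConj L) 3 V.Hm)),
     (1 : ↥(UnitaryGroup.arch (↥(maximalRealSubfield L)) (L : Type) (IsCMField.complexConj L) 2 (Matrix.diagonal (dW S))))))
  (dV : ↥(UnitaryGroup.archIsotropy (L : Type) V.Hm τ T hT) → {v : InfinitePlace ↥(maximalRealSubfield L) // v.IsReal} → ℂ)
  (hd : ∀ (k : ↥(UnitaryGroup.archIsotropy (L : Type) V.Hm τ T hT)) (w : {v : InfinitePlace ↥(maximalRealSubfield L) // v.IsReal}) (m : ∀ b : InfinitePlace (L : Type), ((printPlaces (InfinitePlace (L : Type))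
      (kindOf (L : Type) (frameD V) (frameD_real V) (dW S) (dW_real S) ι₁ datum) (lamOf (L : Type) (frameD V) (frameD_real V) (dW S) (dW_real S) ι₁ datum)
      (lamOf_ne_zero (L : Type) (frameD V) (frameD_real V) (dW S) (dW_real S) ι₁ datum)
      (pinnedVacs (kindOf (L : Type) (frameD V) (frameD_real V) (dW S) (dW_real S) ι₁ datum) m₁ m₂)).loc b).M),
    linSubst (star ((reindexUnitary (pairFrame (PosIdx (cmXV (L : Type) (frameD V) (frameD_real V) ι₁ w))
        (NegIdx (cmXV (L : Type) (frameD V) (frameD_real V) ι₁ w)) (PosIdx (cmXW (L : Type) (frameD V) (dW S) (dW_real S) ι₁ w))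
        (NegIdx (cmXW (L : Type) (frameD V) (dW S) (dW_real S) ι₁ w)) finProdFinEquiv (cmEpsV (L : Type) (frameD V) (frameD_real V) ι₁ w)
        (cmEpsW (L : Type) (frameD V) (dW S) (dW_real S) ι₁ w)) (dualPairι (kVLetters V S (lett k) w)) :
          Matrix.unitaryGroup (Fin 6) ℂ) : Matrix (Fin 6) (Fin 6) ℂ))
        (placePoly (L : Type) (frameD V) (frameD_real V) (dW S) (dW_real S) ι₁ datum m₁ m₂ m w) =
      dV k w • placePoly (L : Type) (frameD V) (frameD_real V) (dW S) (dW_real S) ι₁ datum m₁ m₂ m w)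
  (hκ : ∀ k : ↥(UnitaryGroup.archIsotropy (L : Type) V.Hm τ T hT),
    ((η (kPair V S τ T hT k) : ℂˣ) : ℂ) * ((pinLetterChar V S hGR hW (kVLetters V S (lett k)) : Circle) : ℂ) * ∏ w, dV k w =
      ((UnitaryGroup.archKappa (L : Type) V.Hm τ T hT k : ℂˣ) : ℂ))

include hV hlett hd hκ in
/-- **`ins_mem` ON PURE TENSORS from the lettering (c), the place eigen-equations (d) and the identity (e).** -/
theorem ins_tprod_mem_SK_of_letters (f : FinSB ↥(maximalRealSubfield L) (Fin 6))
    (m : ∀ b : InfinitePlace (L : Type), ((printPlaces (InfinitePlace (L : Type))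
      (kindOf (L : Type) (frameD V) (frameD_real V) (dW S) (dW_real S) ι₁ datum) (lamOf (L : Type) (frameD V) (frameD_real V) (dW S) (dW_real S) ι₁ datum)
      (lamOf_ne_zero (L : Type) (frameD V) (frameD_real V) (dW S) (dW_real S) ι₁ datum)
      (pinnedVacs (kindOf (L : Type) (frameD V) (frameD_real V) (dW S) (dW_real S) ι₁ datum) m₁ m₂)).loc b).M) :
    ins (L : Type) (frameD V) (frameD_real V) (frameD_ne V) (dW S) (dW_real S) (dW_ne S) ι₁ datum m₁ m₂ f (PiTensorProduct.tprod ℂ m) ∈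
      (wmInputCM₂g V S hGR η hη hηc τ T hT).SK := by
  refine (wmInputCM₂g_mem_SK_iff_arch V S hGR η hη hηc τ T hT hV hW _).2 fun k => ?_
  rw [wmInputCM₂g_ρ_eq_of V S hGR η hη hηc τ T hT hW]
  change cmPairRepTwist (L : Type) finProdFinEquiv (frameD V) (frameD_real V) (frameD_ne V) (dW S) (dW_real S) (dW_ne S) hGR η
      (kPair V S τ T hT k)
      (ins (L : Type) (frameD V) (frameD_real V) (frameD_ne V) (dW S) (dW_real S) (dW_ne S) ι₁ datum m₁ m₂ f (PiTensorProduct.tprod ℂ m)) = _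
  have hp : kPair V S τ T hT k =
      archProdHom (↥(maximalRealSubfield L)) (L : Type) (IsCMField.complexConj L) 3 2 (Matrix.diagonal (frameD V)) (Matrix.diagonal (dW S))
        (letterSection (L : Type) (frameD V) (frameD_real V) (frameD_ne V) (dW S) (dW_real S) (dW_ne S) ι₁ (kVLetters V S (lett k))) := by
    rw [hlett]
  rw [hp, cmPairRepTwist_letterSection_ins_tprod_of_eigen (L : Type) (frameD V) (frameD_real V) (frameD_ne V) (dW S) (dW_real S)
    (dW_ne S) hGR ι₁ (frameD_sign_ι₁' V) hW (frameD_sign_of_ne V)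
    (fun τ' _ => signs_fin_two fun j => re_apply_ne_zero_of_complexConj_eq (L : Type) τ' (dW_real S j) (dW_ne S j)) η datum m₁ m₂
    (kVLetters V S (lett k)) f m (dV k) (fun w => hd k w m), ← hp, hκ k]
  rfl

include hV hlett hd hκ in
/-- **THE CENSUS FIELD `ins_mem` (rows 18/19, junction (J-x₀)) at the W pin of record, for EVERY printed vector**, from (c)+(d)+(e). -/
theorem ins_mem_SK_of_letters (f : FinSB ↥(maximalRealSubfield L) (Fin 6))
    (φ : (printPlaces (InfinitePlace (L : Type))
      (kindOf (L : Type) (frameD V) (frameD_real V) (dW S) (dW_real S) ι₁ datum) (lamOf (L : Type) (frameD V) (frameD_real V) (dW S) (dW_real S) ι₁ datum)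
      (lamOf_ne_zero (L : Type) (frameD V) (frameD_real V) (dW S) (dW_real S) ι₁ datum)
      (pinnedVacs (kindOf (L : Type) (frameD V) (frameD_real V) (dW S) (dW_real S) ι₁ datum) m₁ m₂)).F) :
    ins (L : Type) (frameD V) (frameD_real V) (frameD_ne V) (dW S) (dW_real S) (dW_ne S) ι₁ datum m₁ m₂ f φ ∈
      (wmInputCM₂g V S hGR η hη hηc τ T hT).SK := by
  have hmem : φ ∈ Submodule.span ℂ (Set.range (PiTensorProduct.tprod ℂ)) := by
    rw [PiTensorProduct.span_tprod_eq_top]; exact Submodule.mem_top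
  induction hmem using Submodule.span_induction with
  | mem g hg =>
    obtain ⟨m, rfl⟩ := hg
    exact ins_tprod_mem_SK_of_letters V S hGR η hη hηc τ T hT hV hW datum m₁ m₂ lett hlett dV hd hκ f m
  | zero => rw [map_zero]; exact Submodule.zero_mem _
  | add x y _ _ hx hy => rw [map_add]; exact Submodule.add_mem _ hx hy
  | smul a x _ hx => rw [map_smul]; exact Submodule.smul_mem _ a hx

end Pin

end HodgeCM.Model.HypCensus

end
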